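import Summits.HodgeConjecture.CorCM.MumfordTateRankTypeIVThreefoldPairsCells
import Summits.HodgeConjecture.CorCM.MumfordTateRankTimesLowGeneric
import Summits.HodgeConjecture.CorCM.MumfordTateRankTimesRealMultiplicationCells
import Summits.HodgeConjecture.CorCM.MumfordTateRankCMThreefoldTimesCurves
import Summits.HodgeConjecture.CorCM.MumfordTateRankCMProductMonotone
import Summits.HodgeConjecture.CorCM.MumfordTateRankRigidMonotone
import Summits.HodgeConjecture.CorCM.MumfordTateRankSubadditive
import Summits.HodgeConjecture.CorCM.MumfordTateRankOfPowers
import HarnessLib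

/-!
# Two simple abelian THREEFOLDS: `t(T × T') ∈ {4, …, 7} ∪ {10, …, 19} ∪ {22, 25, 31, 43}` — the partition {3,3} of a non-simple sixfold, with the exact
# cells `43, 31, 31, 25` (`End⁰T = ℚ`), `19, 19, 13` (real cubic field), `t(T)` (isogenous) and bounds for the type-IV/CM pairs (Moonen–Zarhin 1999)

COR-CM (cell `pub-hodgecm2`, seat `b27` gen 50, count-neutral Mumford–Tate-rank ladder; theorems only, no definition, no named fact;
UNCONDITIONAL — nothing here uses or asserts HC_CM).  Notation `t(X) = dim MT(H¹X)`; a simple threefold has `dim_ℚ End⁰ ∈ {1, 2, 3, 6}` and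
`t ∈ {22, 10, 10, 4}` (`CorCM/MumfordTateRankSimpleThreefolds`).

THE TABLE for `X ∼ T × T'`, `T`, `T'` simple threefolds:
* `T ∼ T'`: `t(X) = t(T) ∈ {4, 10, 22}`;
* `End⁰T = ℚ`, `T ≁ T'`: `t(X) = t(T') + 21` (`CorCM/MumfordTateRankTimesLowGeneric`): `43 / 31 / 31 / 25` as `dim_ℚ End⁰T' = 1 / 2 / 3 / 6`;
* `End⁰T` a real cubic field, `T ≁ T'`: `t(X) = t(T') + 9` (`CorCM/MumfordTateRankTimesRealMultiplicationCells`): `19 / 19 / 13` for `dim_ℚ End⁰T' = 2 / 3 / 6`;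
* both of type IV(2,1): `10 ≤ t ≤ 19` (`≤ 18` for isomorphic fields, `CorCM/MumfordTateRankTypeIVThreefoldPairsCells`);
* type IV × CM: `10 ≤ t ≤ 13`;  CM × CM: `4 ≤ t ≤ 7` (`CorCM/MumfordTateRankCMProductMonotone`, subadditivity).

* **`mtRank_hodge_one_mem_of_isIsogenous_prod_isSimple_threefolds`** — the union `{4,…,7} ∪ {10,…,19} ∪ {22, 25, 31, 43}`.

## References
* [MoonenZarhin1999LowDim] B. Moonen, Yu. G. Zarhin, *Hodge classes on abelian varieties of low dimension*, Math. Ann. 315 (1999), §2 (2.3), §3 (3.1),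
  Lemma (3.4), Prop. (3.8) [corpus: paper:arxiv-math_9901113 pp. 5–7]. [cite: MoonenZarhin1999LowDim, §2 (2.3) and §3 (3.4)]
* [Gordon1999HodgeAVSurvey] B. B. Gordon, *A survey of the Hodge conjecture for abelian varieties*, 7.5–7.7, 9.1. [cite: Gordon1999HodgeAVSurvey, 7.5 and 9.1]
* [MumfordAV1970] D. Mumford, *Abelian Varieties* (1970), §19 Cor. 2 of Thm. 1. [cite: MumfordAV1970, §19 Cor. 2 of Thm. 1]
-/

noncomputable section

open CategoryTheory CategoryTheory.Limits Module

namespace Summit.HodgeConjecture.CorCM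

open Literature.AlgebraicGeometry.Motives
open Literature.AlgebraicGeometry.Motives.AbelianVariety
open Literature.AlgebraicGeometry.Motives.HodgeStructure
open Literature.AlgebraicGeometry.HodgeTheory
open Literature.AlgebraicGeometry.Milne1999 (IsOfCMType isOfCMType_iff_of_isIsogenous hom_eq_zero_of_isSimple_of_not_isIsogenous)

variable [HodgeTensorFacts.{0, 0}] {X T T' : AbelianVariety ℂ} {n : ℕ}

/-! ## §1 Exact rows: isogenous pairs, a factor with `End⁰ = ℚ`, a factor with real cubic multiplication -/

/-- **`T ∼ T'`: `t(T × T') = t(T)`** (a duplicate factor). [cite: MoonenZarhin1999LowDim, §3 (3.1)] -/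
theorem mtRank_hodge_one_eq_of_isIsogenous_prod_threefolds_of_isIsogenous (hX : IsSmoothProjective n X.X) {k : ℕ} (hT : IsSmoothProjective k T.X)
    (hT3 : T.dim = 3) (hTT' : IsIsogenous T T') (hXP : IsIsogenous X (T.prod T')) :
    haveI := BettiUniverse.finite hX 1
    haveI := BettiUniverse.finite hT 1
    (BettiUniverse.hodge exists_isReal_hodgeModel_holds hX 1).mtRank = (BettiUniverse.hodge exists_isReal_hodgeModel_holds hT 1).mtRank :=
  mtRank_hodge_one_eq_of_isIsogenous_powSucc hX hT (by omega) (m := 1) (hXP.trans ((IsIsogenous.refl T).prod hTT'.symm'))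

/-- **`End⁰T = ℚ`, `T ≁ T'`: `t(T × T') = t(T') + 21`, i.e. `43 / 31 / 31 / 25`** as `dim_ℚ End⁰T' = 1 / 2 / 3 / 6` (`Hg(T) = Sp₆`, Lemma (3.4)).
[cite: MoonenZarhin1999LowDim, §2 (2.3) and §3 (3.4)] -/
theorem mtRank_hodge_one_of_isIsogenous_prod_threefolds_endRankOne (hX : IsSmoothProjective n X.X) (hT3 : T.dim = 3)
    (hTE : Module.finrank ℚ T.endAlgebra = 1) (hT's : T'.IsSimple) (hT'3 : T'.dim = 3) (hTT' : ¬ IsIsogenous T T') (hXP : IsIsogenous X (T.prod T')) :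
    haveI := BettiUniverse.finite hX 1
    (Module.finrank ℚ T'.endAlgebra = 1 ∧ (BettiUniverse.hodge exists_isReal_hodgeModel_holds hX 1).mtRank = 43) ∨
      (Module.finrank ℚ T'.endAlgebra = 2 ∧ (BettiUniverse.hodge exists_isReal_hodgeModel_holds hX 1).mtRank = 31) ∨
      (Module.finrank ℚ T'.endAlgebra = 3 ∧ (BettiUniverse.hodge exists_isReal_hodgeModel_holds hX 1).mtRank = 31) ∨
      (Module.finrank ℚ T'.endAlgebra = 6 ∧ (BettiUniverse.hodge exists_isReal_hodgeModel_holds hX 1).mtRank = 25) := by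
  haveI := BettiUniverse.finite hX 1
  have hT' : IsSmoothProjective T'.dim T'.X := AbelianVariety.isSmoothProjective_holds
  haveI := BettiUniverse.finite hT' 1
  have hTs : T.IsSimple := isSimple_of_threefold_of_finrank_endAlgebra_eq_one hT3 hTE
  have hHom : ∀ u : T' ⟶ T, u = 0 := hom_eq_zero_of_isSimple_of_not_isIsogenous hT's hTs (fun h => hTT' h.symm')
  have h := mtRank_hodge_one_eq_add_of_isIsogenous_prod_threefold_endRankOne hX hT' (by omega) hT3 hTE hHom (hXP.trans (isIsogenous_prod_comm T T'))
  rcases mtRank_hodge_one_of_isSimple_threefold hT' hT's hT'3 with ⟨h1, h22⟩ | ⟨h2, h10⟩ | ⟨h3, h10⟩ | ⟨h6, -, h4⟩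
  · exact Or.inl ⟨h1, by omega⟩
  · exact Or.inr (Or.inl ⟨h2, by omega⟩)
  · exact Or.inr (Or.inr (Or.inl ⟨h3, by omega⟩))
  · exact Or.inr (Or.inr (Or.inr ⟨h6, by omega⟩))

/-- **`End⁰T` a real cubic field, `T ≁ T'`: `t(T × T') = t(T') + 9`, i.e. `31 / 19 / 19 / 13`** as `dim_ℚ End⁰T' = 1 / 2 / 3 / 6`
(`Hg(T) = R_{F/ℚ} SL₂`, Murty's exchange). [cite: MoonenZarhin1999LowDim, §2 (2.3) and §3 (3.4)] -/
theorem mtRank_hodge_one_of_isIsogenous_prod_threefolds_cubicEnd (hX : IsSmoothProjective n X.X) (hTs : T.IsSimple) (hT3 : T.dim = 3)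
    (hTE : Module.finrank ℚ T.endAlgebra = 3) (hT's : T'.IsSimple) (hT'3 : T'.dim = 3) (hTT' : ¬ IsIsogenous T T') (hXP : IsIsogenous X (T.prod T')) :
    haveI := BettiUniverse.finite hX 1
    (Module.finrank ℚ T'.endAlgebra = 1 ∧ (BettiUniverse.hodge exists_isReal_hodgeModel_holds hX 1).mtRank = 31) ∨
      (Module.finrank ℚ T'.endAlgebra = 2 ∧ (BettiUniverse.hodge exists_isReal_hodgeModel_holds hX 1).mtRank = 19) ∨
      (Module.finrank ℚ T'.endAlgebra = 3 ∧ (BettiUniverse.hodge exists_isReal_hodgeModel_holds hX 1).mtRank = 19) ∨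
      (Module.finrank ℚ T'.endAlgebra = 6 ∧ (BettiUniverse.hodge exists_isReal_hodgeModel_holds hX 1).mtRank = 13) := by
  haveI := BettiUniverse.finite hX 1
  have hT' : IsSmoothProjective T'.dim T'.X := AbelianVariety.isSmoothProjective_holds
  haveI := BettiUniverse.finite hT' 1
  have hHom : ∀ u : T' ⟶ T, u = 0 := hom_eq_zero_of_isSimple_of_not_isIsogenous hT's hTs (fun h => hTT' h.symm')
  have h := mtRank_hodge_one_eq_add_nine_of_isIsogenous_prod_threefold_of_finrank_endAlgebra_eq_three hX hT' (by omega) hTs hT3 hTE hHom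
    (hXP.trans (isIsogenous_prod_comm T T'))
  rcases mtRank_hodge_one_of_isSimple_threefold hT' hT's hT'3 with ⟨h1, h22⟩ | ⟨h2, h10⟩ | ⟨h3, h10⟩ | ⟨h6, -, h4⟩
  · exact Or.inl ⟨h1, by omega⟩
  · exact Or.inr (Or.inl ⟨h2, by omega⟩)
  · exact Or.inr (Or.inr (Or.inl ⟨h3, by omega⟩))
  · exact Or.inr (Or.inr (Or.inr ⟨h6, by omega⟩))

/-! ## §2 Bounds: two type-IV(2,1) threefolds, type IV × CM, CM × CM -/

/-- **Two simple type-IV(2,1) threefolds: `10 ≤ t(T × T') ≤ 19`** (`t(T) = 10 ≤ t` by the `Θ`-rigidity of `T`; `t + 1 ≤ 10 + 10`); `≤ 18` when the fields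
are isomorphic (`CorCM/MumfordTateRankTypeIVThreefoldPairsCells`). [cite: MoonenZarhin1999LowDim, §2 (2.3) and §3 (3.1)] -/
theorem mtRank_hodge_one_mem_Icc_of_isIsogenous_prod_typeIV_threefolds (hX : IsSmoothProjective n X.X) (hTs : T.IsSimple) (hT3 : T.dim = 3)
    (hTE : Module.finrank ℚ T.endAlgebra = 2) (hT's : T'.IsSimple) (hT'3 : T'.dim = 3) (hT'E : Module.finrank ℚ T'.endAlgebra = 2)
    (hXP : IsIsogenous X (T.prod T')) :
    haveI := BettiUniverse.finite hX 1
    10 ≤ (BettiUniverse.hodge exists_isReal_hodgeModel_holds hX 1).mtRank ∧ (BettiUniverse.hodge exists_isReal_hodgeModel_holds hX 1).mtRank ≤ 19 := by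
  haveI := BettiUniverse.finite hX 1
  have hT : IsSmoothProjective T.dim T.X := AbelianVariety.isSmoothProjective_holds
  have hT' : IsSmoothProjective T'.dim T'.X := AbelianVariety.isSmoothProjective_holds
  haveI := BettiUniverse.finite hT 1
  haveI := BettiUniverse.finite hT' 1
  have h10 := (mtRank_hodge_one_of_isSimple_threefold_of_finrank_endAlgebra_eq_two hT hTs hT3 hTE).1
  have h10' := (mtRank_hodge_one_of_isSimple_threefold_of_finrank_endAlgebra_eq_two hT' hT's hT'3 hT'E).1
  have hge := ten_le_mtRank_hodge_one_of_isIsogenous_prod_isSimple_threefold_of_finrank_eq_two (A := T') hX hTs hT3 hTE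
    (hXP.trans (isIsogenous_prod_comm T T'))
  have hle := mtRank_hodge_one_add_one_le_add_of_isIsogenous_prod hT hT' (by omega) (by omega) hX hXP
  omega

/-- **Simple type-IV(2,1) threefold × simple CM threefold: `10 ≤ t(T × T') ≤ 13`** (`t(T) ≤ t` by rigidity; `t + 1 ≤ 10 + 4`).  The exact value
(`13` unless the sextic CM field of `T'` resonates with `End⁰T`) would need Moonen–Zarhin's Lemma (3.6) for a sextic abelian summand.
[cite: MoonenZarhin1999LowDim, §2 (2.3), §3 (3.1) and (3.6)] -/
theorem mtRank_hodge_one_mem_Icc_of_isIsogenous_prod_typeIV_cmThreefold (hX : IsSmoothProjective n X.X) (hTs : T.IsSimple) (hT3 : T.dim = 3)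
    (hTE : Module.finrank ℚ T.endAlgebra = 2) (hT's : T'.IsSimple) (hT'3 : T'.dim = 3) (hT'cm : IsOfCMType T') (hXP : IsIsogenous X (T.prod T')) :
    haveI := BettiUniverse.finite hX 1
    10 ≤ (BettiUniverse.hodge exists_isReal_hodgeModel_holds hX 1).mtRank ∧ (BettiUniverse.hodge exists_isReal_hodgeModel_holds hX 1).mtRank ≤ 13 := by
  haveI := BettiUniverse.finite hX 1
  have hT : IsSmoothProjective T.dim T.X := AbelianVariety.isSmoothProjective_holds
  have hT' : IsSmoothProjective T'.dim T'.X := AbelianVariety.isSmoothProjective_holds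
  haveI := BettiUniverse.finite hT 1
  haveI := BettiUniverse.finite hT' 1
  have h10 := (mtRank_hodge_one_of_isSimple_threefold_of_finrank_endAlgebra_eq_two hT hTs hT3 hTE).1
  have h4 := mtRank_hodge_one_eq_four_of_isSimple_cmThreefold hT' hT's hT'3 hT'cm
  have hge := ten_le_mtRank_hodge_one_of_isIsogenous_prod_isSimple_threefold_of_finrank_eq_two (A := T') hX hTs hT3 hTE
    (hXP.trans (isIsogenous_prod_comm T T'))
  have hle := mtRank_hodge_one_add_one_le_add_of_isIsogenous_prod hT hT' (by omega) (by omega) hX hXP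
  omega

/-- **Two simple CM threefolds: `4 ≤ t(T × T') ≤ 7`** (`t(T) ≤ t` by the monotonicity of the Mumford–Tate rank for CM products,
`CorCM/MumfordTateRankCMProductMonotone`; `t + 1 ≤ 4 + 4`); `4` for `T ∼ T'`. [cite: MoonenZarhin1999LowDim, §3 (3.1)]
[cite: Gordon1999HodgeAVSurvey, 7.5 and 9.1] -/
theorem mtRank_hodge_one_mem_Icc_of_isIsogenous_prod_cmThreefolds (hX : IsSmoothProjective n X.X) (hTs : T.IsSimple) (hT3 : T.dim = 3)
    (hTcm : IsOfCMType T) (hT's : T'.IsSimple) (hT'3 : T'.dim = 3) (hT'cm : IsOfCMType T') (hXP : IsIsogenous X (T.prod T')) :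
    haveI := BettiUniverse.finite hX 1
    4 ≤ (BettiUniverse.hodge exists_isReal_hodgeModel_holds hX 1).mtRank ∧ (BettiUniverse.hodge exists_isReal_hodgeModel_holds hX 1).mtRank ≤ 7 := by
  haveI := BettiUniverse.finite hX 1
  have hT : IsSmoothProjective T.dim T.X := AbelianVariety.isSmoothProjective_holds
  have hT' : IsSmoothProjective T'.dim T'.X := AbelianVariety.isSmoothProjective_holds
  haveI := BettiUniverse.finite hT 1
  haveI := BettiUniverse.finite hT' 1
  have h4 := mtRank_hodge_one_eq_four_of_isSimple_cmThreefold hT hTs hT3 hTcm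
  have h4' := mtRank_hodge_one_eq_four_of_isSimple_cmThreefold hT' hT's hT'3 hT'cm
  have hcm : IsOfCMType X := (isOfCMType_iff_of_isIsogenous hXP).2 (Literature.AlgebraicGeometry.Milne1999.isOfCMType_prod_iff.2 ⟨hTcm, hT'cm⟩)
  obtain ⟨hge, -⟩ := mtRank_hodge_one_le_of_isIsogenous_prod_of_isOfCMType hX hT (by omega) hT' (by omega) hcm hXP
  have hle := mtRank_hodge_one_add_one_le_add_of_isIsogenous_prod hT hT' (by omega) (by omega) hX hXP
  omega

/-! ## §3 The assembled table -/

/-- **The partition {3,3}: `t(T × T') ∈ {4, …, 7} ∪ {10, …, 19} ∪ {22, 25, 31, 43}` for every pair of SIMPLE complex abelian threefolds** (exact in the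
rows `T ∼ T'`, `End⁰T = ℚ`, `End⁰T` real cubic; intervals for the type-IV/CM pairs). [cite: MoonenZarhin1999LowDim, §2 (2.3) and §3 (3.4)]
[cite: Gordon1999HodgeAVSurvey, 7.5 and 9.1] -/
theorem mtRank_hodge_one_mem_of_isIsogenous_prod_isSimple_threefolds (hX : IsSmoothProjective n X.X) (hTs : T.IsSimple) (hT3 : T.dim = 3)
    (hT's : T'.IsSimple) (hT'3 : T'.dim = 3) (hXP : IsIsogenous X (T.prod T')) :
    haveI := BettiUniverse.finite hX 1
    (BettiUniverse.hodge exists_isReal_hodgeModel_holds hX 1).mtRank ∈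
      ({4, 5, 6, 7, 10, 11, 12, 13, 14, 15, 16, 17, 18, 19, 22, 25, 31, 43} : Finset ℕ) := by
  classical
  haveI := BettiUniverse.finite hX 1
  have hT : IsSmoothProjective T.dim T.X := AbelianVariety.isSmoothProjective_holds
  have hT' : IsSmoothProjective T'.dim T'.X := AbelianVariety.isSmoothProjective_holds
  haveI := BettiUniverse.finite hT 1
  haveI := BettiUniverse.finite hT' 1
  simp only [Finset.mem_insert, Finset.mem_singleton]
  have hXP' : IsIsogenous X (T'.prod T) := hXP.trans (isIsogenous_prod_comm T T')
  by_cases hTT' : IsIsogenous T T'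
  · have h := mtRank_hodge_one_eq_of_isIsogenous_prod_threefolds_of_isIsogenous hX hT hT3 hTT' hXP
    rcases mtRank_hodge_one_of_isSimple_threefold hT hTs hT3 with ⟨-, h22⟩ | ⟨-, h10⟩ | ⟨-, h10⟩ | ⟨-, -, h4⟩ <;> omega
  have hT'T : ¬ IsIsogenous T' T := fun h => hTT' h.symm'
  rcases AbelianVariety.finrank_endAlgebra_mem_of_isSimple_threefold hTs hT3 with h1 | h2 | h3 | h6
  · rcases mtRank_hodge_one_of_isIsogenous_prod_threefolds_endRankOne hX hT3 h1 hT's hT'3 hTT' hXP with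
      ⟨-, h⟩ | ⟨-, h⟩ | ⟨-, h⟩ | ⟨-, h⟩ <;> omega
  · rcases AbelianVariety.finrank_endAlgebra_mem_of_isSimple_threefold hT's hT'3 with h1' | h2' | h3' | h6'
    · rcases mtRank_hodge_one_of_isIsogenous_prod_threefolds_endRankOne hX hT'3 h1' hTs hT3 hT'T hXP' with
        ⟨-, h⟩ | ⟨-, h⟩ | ⟨-, h⟩ | ⟨-, h⟩ <;> omega
    · obtain ⟨hge, hle⟩ := mtRank_hodge_one_mem_Icc_of_isIsogenous_prod_typeIV_threefolds hX hTs hT3 h2 hT's hT'3 h2' hXP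
      omega
    · rcases mtRank_hodge_one_of_isIsogenous_prod_threefolds_cubicEnd hX hT's hT'3 h3' hTs hT3 hT'T hXP' with
        ⟨-, h⟩ | ⟨-, h⟩ | ⟨-, h⟩ | ⟨-, h⟩ <;> omega
    · obtain ⟨hge, hle⟩ := mtRank_hodge_one_mem_Icc_of_isIsogenous_prod_typeIV_cmThreefold hX hTs hT3 h2 hT's hT'3
        (isOfCMType_of_isSimple_threefold_of_finrank_endAlgebra_eq_six hT's hT'3 h6') hXP
      omega
  · rcases mtRank_hodge_one_of_isIsogenous_prod_threefolds_cubicEnd hX hTs hT3 h3 hT's hT'3 hTT' hXP with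
      ⟨-, h⟩ | ⟨-, h⟩ | ⟨-, h⟩ | ⟨-, h⟩ <;> omega
  · have hTcm : IsOfCMType T := isOfCMType_of_isSimple_threefold_of_finrank_endAlgebra_eq_six hTs hT3 h6
    rcases AbelianVariety.finrank_endAlgebra_mem_of_isSimple_threefold hT's hT'3 with h1' | h2' | h3' | h6'
    · rcases mtRank_hodge_one_of_isIsogenous_prod_threefolds_endRankOne hX hT'3 h1' hTs hT3 hT'T hXP' with
        ⟨-, h⟩ | ⟨-, h⟩ | ⟨-, h⟩ | ⟨-, h⟩ <;> omega
    · obtain ⟨hge, hle⟩ := mtRank_hodge_one_mem_Icc_of_isIsogenous_prod_typeIV_cmThreefold hX hT's hT'3 h2' hTs hT3 hTcm hXP'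
      omega
    · rcases mtRank_hodge_one_of_isIsogenous_prod_threefolds_cubicEnd hX hT's hT'3 h3' hTs hT3 hT'T hXP' with
        ⟨-, h⟩ | ⟨-, h⟩ | ⟨-, h⟩ | ⟨-, h⟩ <;> omega
    · obtain ⟨hge, hle⟩ := mtRank_hodge_one_mem_Icc_of_isIsogenous_prod_cmThreefolds hX hTs hT3 hTcm hT's hT'3
        (isOfCMType_of_isSimple_threefold_of_finrank_endAlgebra_eq_six hT's hT'3 h6') hXP
      omega

end Summit.HodgeConjecture.CorCM

end
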